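import Summits.PneNP.PneNP.Theorems.ChebyshevTracialDesignClassForcing
import Mathlib.Analysis.Matrix.Order
import Mathlib.LinearAlgebra.FiniteDimensional.Lemmas
import HarnessLib

/-!
# Cell pnp-psdrank, route `ChebyshevTracialDesign`, brick 67: the ROBUST SPAN of the cut side — ALL forced directions are collectively junk
# (`≤ B_v·ε·r²`, independently of their number)

Brick 66 (`…ClassForcing`) prices ONE homogeneous atom class at the junk scale `B_v·ε·r` (the cuts seeing its direction carry trace mass
`< ε·r·#t-cuts`), hence `L` classes at `L·B_v·ε·r` — useless when the matching side splits into exponentially many light atoms. This file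
removes the factor `L` by a dimension argument (MEMO-15 §2 of the cell):
* §1 `robust_span` (linear algebra + bookkeeping, no SNT): let `(X_U)` be psd matrices of size `r` on a finite family `F` of cuts and `𝒱` a
  finite set of vectors, each KILLED by `X_U` off an exceptional set of trace mass `< δ`. Then there is a sub-family `F' ⊆ F` on which EVERY
  `v ∈ 𝒱` is killed (`X_U v = 0` for `U ∈ F'`, `v ∈ 𝒱`) and `F ∖ F'` has trace mass `≤ r·δ` — NOT `|𝒱|·δ`. Greedy proof: while some `X_{U₀} v ≠ 0`
  (`U₀ ∈ F`, `v ∈ 𝒱`), discard the exceptional set of `v`; the span `Σ_{U∈F} range X_U` then drops strictly (it contained `X_{U₀}v`, which pairs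
  positively with `v`, while the new span is `⊥ v`), so at most `r` rounds occur (`robust_span_aux`, induction on the dimension of the span).
* §2 `forced_atoms_value_le`: for a tight-orthogonal psd rectangle `(X, Y)` whose matching side is ATOMIC with rank-one atoms,
  `Y_M = y_M·v_{ℓ(M)} v_{ℓ(M)}ᵀ`, every used label class being `(PM_n, τ)`-homogeneous of trace mass `≥ ν·#PM_n` (so FORCED by brick 66 under
  (SNT-q)_w at `(τ, ε, ν)`), the design value of ANY cut family is `≤ B_v·ε·r²`, whatever the number of atoms: on the robust family `F'` the
  kernel vanishes identically, and `F ∖ F'` is priced by the row trace marginal (brick 51). With the budget `r < e^{a·dq n/2}` and `ε = e^{−c·dq n}`,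
  `c > a`, this is exponentially small: inside the budget, homogeneous atoms are free.
[cite: KeevashLifshitz2023, Thm. 1.8] [cite: KupavskiiZakharov2022, §2] [cite: Rothvoss2017, §2 (PDF p. 6)] [cite: BrietDadushPokutta2014, Thm. 6 (§3)]
Stature: support/instrument (kernel theorems, no defs). WHAT THIS IS NOT: light (below-threshold) or non-homogeneous label classes and
non-atomic `Y` are untouched — the dense cell stays open; nothing on psd rank of `P_PM(K_n)`, no P-vs-NP content. Supports stmt-PneNP-19878.
-/

set_option linter.dupNamespace false -- `Summit.PneNP.PneNP.…`: summit = sub-problem (D-0017)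

noncomputable section

namespace Summit.PneNP.PneNP.Theorems.ChebyshevTracialDesignRobustSpan

open Finset Matrix Literature.Barriers.PneNP Literature.Combinatorics.Optimization
open Literature.Combinatorics.SetFamily
open Summit.PneNP.PneNP.Theorems.ChebyshevTracialDesignPsdCells (abs_cell_value_le_row)
open Summit.PneNP.PneNP.Theorems.ChebyshevTracialDesignClassForcing (forcing)

variable {n : ℕ}

/-! ### §1 The robust span -/

/-- A psd matrix that does not kill `v` pairs positively with it: `X v ≠ 0 → 0 < ⟨v, X v⟩`. [folklore] -/
theorem dotProduct_mulVec_pos_of_ne {r : ℕ} {Z : Matrix (Fin r) (Fin r) ℝ} (hZ : Z.PosSemidef) {v : Fin r → ℝ}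
    (hv : Z *ᵥ v ≠ 0) : 0 < v ⬝ᵥ (Z *ᵥ v) := by
  have h0 : 0 ≤ v ⬝ᵥ (Z *ᵥ v) := by simpa using hZ.dotProduct_mulVec_nonneg v
  rcases h0.eq_or_lt with h | h
  · exfalso
    refine hv ((hZ.dotProduct_mulVec_zero_iff v).1 ?_)
    simpa using h.symm
  · exact h

/-- For a real symmetric matrix, `⟨v, X z⟩ = ⟨X v, z⟩`. [folklore] -/
theorem dotProduct_mulVec_of_isHermitian {r : ℕ} {Z : Matrix (Fin r) (Fin r) ℝ} (hZ : Z.IsHermitian) (v z : Fin r → ℝ) :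
    v ⬝ᵥ (Z *ᵥ z) = (Z *ᵥ v) ⬝ᵥ z := by
  have hT : Zᵀ = Z := by
    have := hZ.eq
    rwa [conjTranspose_eq_transpose_of_trivial] at this
  rw [dotProduct_mulVec, ← mulVec_transpose, hT]

/-- **Robust span, inductive form.** `X_U ⪰ 0` on a finite cut family `F`, `𝒱` a finite set of vectors each killed off an exceptional set of
trace mass `< δ` (`δ ≥ 0`); if the span of the ranges `{X_U z : U ∈ F}` has dimension `≤ m`, there is `F' ⊆ F` on which every `v ∈ 𝒱` is killed,
with `Σ_{U ∈ F∖F'} tr X_U ≤ m·δ`. [folklore] -/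
theorem robust_span_aux {r : ℕ} (X : OddSet n → Matrix (Fin r) (Fin r) ℝ) (hX : ∀ U, (X U).PosSemidef)
    (𝒱 : Finset (Fin r → ℝ)) {δ : ℝ} (hδ : 0 ≤ δ) :
    ∀ (m : ℕ) (F : Finset (OddSet n)),
      Module.finrank ℝ (Submodule.span ℝ {w : Fin r → ℝ | ∃ U ∈ F, ∃ z : Fin r → ℝ, X U *ᵥ z = w}) ≤ m →
      (∀ v ∈ 𝒱, ∑ U ∈ F.filter (fun U => X U *ᵥ v ≠ 0), (X U).trace < δ) →
      ∃ F' ⊆ F, (∀ U ∈ F', ∀ v ∈ 𝒱, X U *ᵥ v = 0) ∧ ∑ U ∈ F \ F', (X U).trace ≤ m * δ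
  | 0, F, hm, _ => by
    refine ⟨F, Subset.rfl, fun U hU v _ => ?_, by simp⟩
    have hbot : Submodule.span ℝ {w : Fin r → ℝ | ∃ U ∈ F, ∃ z : Fin r → ℝ, X U *ᵥ z = w} = ⊥ :=
      Submodule.finrank_eq_zero.1 (Nat.le_zero.1 hm)
    have hmem : X U *ᵥ v ∈ Submodule.span ℝ {w : Fin r → ℝ | ∃ U ∈ F, ∃ z : Fin r → ℝ, X U *ᵥ z = w} :=
      Submodule.subset_span ⟨U, hU, v, rfl⟩
    rw [hbot, Submodule.mem_bot] at hmem
    exact hmem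
  | m + 1, F, hm, hF => by
    classical
    by_cases hall : ∀ U ∈ F, ∀ v ∈ 𝒱, X U *ᵥ v = 0
    · refine ⟨F, Subset.rfl, hall, ?_⟩
      rw [Finset.sdiff_self, sum_empty]
      exact mul_nonneg (Nat.cast_nonneg _) hδ
    push Not at hall
    obtain ⟨U₀, hU₀, v, hv, hne⟩ := hall
    set F₁ : Finset (OddSet n) := F.filter (fun U => X U *ᵥ v = 0) with hF₁
    -- the new span is orthogonal to `v`, the old one is not
    let φ : (Fin r → ℝ) →ₗ[ℝ] ℝ :=
      { toFun := fun w => v ⬝ᵥ w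
        map_add' := fun a b => dotProduct_add v a b
        map_smul' := fun c a => by simp [dotProduct_smul] }
    have hker : Submodule.span ℝ {w : Fin r → ℝ | ∃ U ∈ F₁, ∃ z : Fin r → ℝ, X U *ᵥ z = w} ≤ LinearMap.ker φ := by
      refine Submodule.span_le.2 ?_
      rintro w ⟨U, hU, z, rfl⟩
      have hUv : X U *ᵥ v = 0 := (mem_filter.1 hU).2
      change v ⬝ᵥ (X U *ᵥ z) = 0
      rw [dotProduct_mulVec_of_isHermitian (hX U).1, hUv, zero_dotProduct]
    have hle : Submodule.span ℝ {w : Fin r → ℝ | ∃ U ∈ F₁, ∃ z : Fin r → ℝ, X U *ᵥ z = w} ≤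
        Submodule.span ℝ {w : Fin r → ℝ | ∃ U ∈ F, ∃ z : Fin r → ℝ, X U *ᵥ z = w} :=
      Submodule.span_mono fun w ⟨U, hU, z, hz⟩ => ⟨U, (mem_filter.1 hU).1, z, hz⟩
    have hin : X U₀ *ᵥ v ∈ Submodule.span ℝ {w : Fin r → ℝ | ∃ U ∈ F, ∃ z : Fin r → ℝ, X U *ᵥ z = w} :=
      Submodule.subset_span ⟨U₀, hU₀, v, rfl⟩
    have hnot : X U₀ *ᵥ v ∉ Submodule.span ℝ {w : Fin r → ℝ | ∃ U ∈ F₁, ∃ z : Fin r → ℝ, X U *ᵥ z = w} := by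
      intro h
      have h1 := hker h
      rw [LinearMap.mem_ker] at h1
      change v ⬝ᵥ (X U₀ *ᵥ v) = 0 at h1
      exact (dotProduct_mulVec_pos_of_ne (hX U₀) hne).ne' h1
    have hlt : Submodule.span ℝ {w : Fin r → ℝ | ∃ U ∈ F₁, ∃ z : Fin r → ℝ, X U *ᵥ z = w} <
        Submodule.span ℝ {w : Fin r → ℝ | ∃ U ∈ F, ∃ z : Fin r → ℝ, X U *ᵥ z = w} :=
      lt_of_le_of_ne hle fun heq => hnot (heq ▸ hin)
    have hm₁ : Module.finrank ℝ (Submodule.span ℝ {w : Fin r → ℝ | ∃ U ∈ F₁, ∃ z : Fin r → ℝ, X U *ᵥ z = w}) ≤ m :=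
      Nat.lt_succ_iff.1 (lt_of_lt_of_le (Submodule.finrank_lt_finrank_of_lt hlt) hm)
    have hF₁hyp : ∀ v' ∈ 𝒱, ∑ U ∈ F₁.filter (fun U => X U *ᵥ v' ≠ 0), (X U).trace < δ := fun v' hv' =>
      lt_of_le_of_lt (sum_le_sum_of_subset_of_nonneg (filter_subset_filter _ (filter_subset _ _))
        fun U _ _ => (hX U).trace_nonneg) (hF v' hv')
    obtain ⟨F', hF'sub, hkill, hmass⟩ := robust_span_aux X hX 𝒱 hδ m F₁ hm₁ hF₁hyp
    refine ⟨F', hF'sub.trans (filter_subset _ _), hkill, ?_⟩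
    -- bookkeeping: `F ∖ F' = (F ∖ F₁) ⊔ (F₁ ∖ F')`
    have hsplit : F \ F' = (F.filter fun U => X U *ᵥ v ≠ 0) ∪ (F₁ \ F') := by
      ext U
      simp only [mem_sdiff, mem_union, mem_filter, hF₁]
      constructor
      · rintro ⟨hUF, hUF'⟩
        by_cases h : X U *ᵥ v = 0
        · exact Or.inr ⟨⟨hUF, h⟩, hUF'⟩
        · exact Or.inl ⟨hUF, h⟩
      · rintro (⟨hUF, h⟩ | ⟨⟨hUF, _⟩, hUF'⟩)
        · exact ⟨hUF, fun hU' => h (hkill U hU' v hv)⟩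
        · exact ⟨hUF, hUF'⟩
    have hdisj : Disjoint (F.filter fun U => X U *ᵥ v ≠ 0) (F₁ \ F') := by
      rw [disjoint_left]
      intro U hU hU'
      exact (mem_filter.1 hU).2 (mem_filter.1 (mem_sdiff.1 hU').1).2
    rw [hsplit, sum_union hdisj]
    have h1 := hF v hv
    push_cast
    linarith

/-- **THE ROBUST SPAN.** For psd `X_U` (size `r`) on a finite cut family `F` and a finite set `𝒱` of vectors, each killed by `X_U` off an
exceptional subset of `F` of trace mass `< δ` (`δ ≥ 0`), there is `F' ⊆ F` on which all of `𝒱` is killed simultaneously and whose complement has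
trace mass `≤ r·δ` (independently of `|𝒱|`). [folklore] -/
theorem robust_span {r : ℕ} (X : OddSet n → Matrix (Fin r) (Fin r) ℝ) (hX : ∀ U, (X U).PosSemidef) (𝒱 : Finset (Fin r → ℝ))
    {δ : ℝ} (hδ : 0 ≤ δ) (F : Finset (OddSet n)) (hF : ∀ v ∈ 𝒱, ∑ U ∈ F.filter (fun U => X U *ᵥ v ≠ 0), (X U).trace < δ) :
    ∃ F' ⊆ F, (∀ U ∈ F', ∀ v ∈ 𝒱, X U *ᵥ v = 0) ∧ ∑ U ∈ F \ F', (X U).trace ≤ r * δ := by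
  refine robust_span_aux X hX 𝒱 hδ r F ?_ hF
  calc Module.finrank ℝ (Submodule.span ℝ {w : Fin r → ℝ | ∃ U ∈ F, ∃ z : Fin r → ℝ, X U *ᵥ z = w})
      ≤ Module.finrank ℝ (Fin r → ℝ) := Submodule.finrank_le _
    _ = r := Module.finrank_fin_fun ℝ

/-! ### §2 Forced atoms are collectively junk -/

/-- Tightness against a rank-one atom kills its direction: `X (y·v vᵀ) = 0`, `y > 0`, `v ≠ 0` ⇒ `X v = 0`. [cite: BrietDadushPokutta2014, Thm. 6 (§3)] -/
theorem mulVec_eq_zero_of_atom {r : ℕ} {Z W : Matrix (Fin r) (Fin r) ℝ} {c : ℝ} {v : Fin r → ℝ} (hc : 0 < c)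
    (hW : W = c • vecMulVec v v) (hv : v ≠ 0) (h : Z * W = 0) : Z *ᵥ v = 0 := by
  rw [hW, Matrix.mul_smul, mul_vecMulVec] at h
  have h1 : vecMulVec (Z *ᵥ v) v = 0 := (smul_eq_zero.1 h).resolve_left hc.ne'
  exact ((vecMulVec_eq_zero).1 h1).resolve_right hv

/-- The kernel against a rank-one atom: `tr(X·(y·v vᵀ)) = y·⟨X v, v⟩`, so it vanishes when `X v = 0`. [folklore] -/
theorem trace_mul_atom {r : ℕ} (Z : Matrix (Fin r) (Fin r) ℝ) (c : ℝ) (v : Fin r → ℝ) :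
    (Z * (c • vecMulVec v v)).trace = c * ((Z *ᵥ v) ⬝ᵥ v) := by
  rw [Matrix.mul_smul, trace_smul, mul_vecMulVec, trace_vecMulVec, smul_eq_mul]

/-- **FORCED ATOMS ARE COLLECTIVELY JUNK.** Let `(X, Y)` be a tight-orthogonal psd rectangle of dimension `r ≥ 1` whose matching side is atomic
with rank-one atoms, `Y_M = y_M·v_{ℓ(M)} v_{ℓ(M)}ᵀ` (`y ≥ 0`), assume (SNT-q)_w at `(τ, ε, ν)` (`ε ≥ 0`; the shape discharged by brick 65), and
suppose every label `i` carried by some `M` with `y_M > 0` lies in a finite set `J` whose classes `{M : ℓ M = i, y_M > 0}` have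
`(PM_n, τ)`-homogeneous trace weight of mass `≥ ν·#PM_n`. Then for every cut family `A` and every level weight with `Σ|w_c| ≤ B_v`:
`Σ_{U∈A} Σ_M W(U,M)·tr(X_U Y_M) ≤ B_v·ε·r²` — independently of `|J|`. (Brick 66 forces each direction off trace mass `ε·r·#t-cuts`; §1 makes the
exceptional sets simultaneous at cost `r`; the rest of the kernel vanishes identically.)
[cite: KeevashLifshitz2023, Thm. 1.8] [cite: KupavskiiZakharov2022, §2] [cite: Rothvoss2017, §2 (PDF p. 6)] -/
theorem forced_atoms_value_le {t r : ℕ} (hr : 0 < r) {τ ε ν : ℝ} (hε : 0 ≤ ε) (C : Finset ℕ) (w : ℕ → ℝ) {Bv : ℝ}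
    (hBv : ∑ c ∈ C, |w c| ≤ Bv)
    (hSNT : ∀ (x : OddSet n → ℝ) (z : PMatch n → ℝ), (∀ U, 0 ≤ x U ∧ x U ≤ 1) → (∀ U, U.1.card ≠ t → x U = 0) →
      ε * ((univ.filter fun U : OddSet n => U.1.card = t).card : ℝ) ≤ ∑ U, x U → (∀ M, 0 ≤ z M ∧ z M ≤ 1) →
      IsRelHomogeneousW τ (perfectMatchings (univ : Finset (Fin n)))
        (fun M : Finset (Sym2 (Fin n)) => if hM : IsPMOn (univ : Finset (Fin n)) M then z ⟨M, hM⟩ else 0)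
        ((univ : Finset (PMatch n)).image Subtype.val) →
      ν * (Fintype.card (PMatch n) : ℝ) ≤ ∑ M, z M → ∃ U M, cc U M = 1 ∧ 0 < x U ∧ 0 < z M)
    {X : OddSet n → Matrix (Fin r) (Fin r) ℝ} {Y : PMatch n → Matrix (Fin r) (Fin r) ℝ} (hXY : IsPsdRect X Y)
    {ι : Type*} [DecidableEq ι] (ℓ : PMatch n → ι) (v : ι → Fin r → ℝ) (y : PMatch n → ℝ) (hy : ∀ M, 0 ≤ y M)
    (hY : ∀ M, Y M = y M • vecMulVec (v (ℓ M)) (v (ℓ M))) (J : Finset ι) (hJ : ∀ M, 0 < y M → ℓ M ∈ J)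
    (hhom : ∀ i ∈ J, IsRelHomogeneousW τ (perfectMatchings (univ : Finset (Fin n)))
      (fun M : Finset (Sym2 (Fin n)) => if hM : IsPMOn (univ : Finset (Fin n)) M then
        (if (⟨M, hM⟩ : PMatch n) ∈ univ.filter (fun M : PMatch n => ℓ M = i ∧ 0 < y M) then (Y ⟨M, hM⟩).trace / r else 0) else 0)
      ((univ : Finset (PMatch n)).image Subtype.val))
    (hmass : ∀ i ∈ J, ν * (Fintype.card (PMatch n) : ℝ) ≤ ∑ M ∈ univ.filter (fun M : PMatch n => ℓ M = i ∧ 0 < y M), (Y M).trace / r)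
    (A : Finset (OddSet n)) :
    ∑ U ∈ A, ∑ M, levelWeight n t C w U M * (X U * Y M).trace ≤ Bv * ε * r ^ 2 := by
  classical
  have hBw : 0 ≤ ∑ c ∈ C, |w c| := sum_nonneg fun c _ => abs_nonneg (w c)
  have hBv0 : 0 ≤ Bv := hBw.trans hBv
  have hr' : (0 : ℝ) < r := by exact_mod_cast hr
  set N : ℝ := ((univ.filter fun U : OddSet n => U.1.card = t).card : ℝ) with hN
  set F : Finset (OddSet n) := univ.filter fun U : OddSet n => U.1.card = t with hFdef
  -- each used direction is forced off trace mass `ε·r·N`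
  have hforce : ∀ u ∈ J.image v, ∑ U ∈ F.filter (fun U => X U *ᵥ u ≠ 0), (X U).trace < ε * r * N := by
    intro u hu
    obtain ⟨i, hi, rfl⟩ := mem_image.1 hu
    have h := forcing hr hSNT hXY (univ.filter (fun M : PMatch n => ℓ M = i ∧ 0 < y M)) (hhom i hi) (hmass i hi)
      (fun U => X U *ᵥ v i ≠ 0) fun M hM U hPU hXYz => ?_
    · have hset : univ.filter (fun U : OddSet n => U.1.card = t ∧ X U *ᵥ v i ≠ 0) = F.filter (fun U => X U *ᵥ v i ≠ 0) := by
        rw [hFdef, filter_filter]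
      rw [hset] at h
      exact h
    · obtain ⟨hℓ, hyM⟩ := (mem_filter.1 hM).2
      by_cases hv0 : v i = 0
      · exact hPU (by rw [hv0, mulVec_zero])
      · exact hPU (mulVec_eq_zero_of_atom hyM (by rw [hY M, hℓ]) hv0 hXYz)
  -- the robust family
  obtain ⟨F', hF'F, hkill, hjunk⟩ :=
    robust_span X (fun U => (hXY.1 U).1) (J.image v) (by positivity : (0 : ℝ) ≤ ε * r * N) F hforce
  -- on `F'` the kernel vanishes identically; off the `t`-cuts the weight vanishes via the row marginal
  have hzero : ∀ U ∈ F', ∀ M, (X U * Y M).trace = 0 := by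
    intro U hU M
    rw [hY M, trace_mul_atom]
    rcases (hy M).eq_or_lt with h0 | hpos
    · rw [← h0, zero_mul]
    · rw [hkill U hU (v (ℓ M)) (mem_image_of_mem v (hJ M hpos)), zero_dotProduct, mul_zero]
  rw [← sum_filter_add_sum_filter_not A (fun U => U ∈ F')]
  have hA1 : ∑ U ∈ A.filter (fun U => U ∈ F'), ∑ M, levelWeight n t C w U M * (X U * Y M).trace = 0 :=
    sum_eq_zero fun U hU => sum_eq_zero fun M _ => by rw [hzero U (mem_filter.1 hU).2 M, mul_zero]
  rw [hA1, zero_add]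
  have hrow := abs_cell_value_le_row (t := t) hr C w hXY (A.filter fun U => U ∉ F') univ
  have hsub : ∑ U ∈ (A.filter fun U => U ∉ F').filter (fun U => U.1.card = t), (X U).trace ≤ ∑ U ∈ F \ F', (X U).trace := by
    refine sum_le_sum_of_subset_of_nonneg (fun U hU => ?_) fun U _ _ => (hXY.1 U).1.trace_nonneg
    simp only [mem_filter, mem_sdiff, hFdef, mem_univ, true_and] at hU ⊢
    exact ⟨hU.2, hU.1.2⟩
  rcases eq_or_lt_of_le (Nat.cast_nonneg (α := ℝ) ((univ.filter fun U : OddSet n => U.1.card = t).card)) with hN0 | hNpos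
  · have hempty : (univ.filter fun U : OddSet n => U.1.card = t) = ∅ := by
      rw [← card_eq_zero]; exact_mod_cast hN0.symm
    have hE : (A.filter fun U => U ∉ F').filter (fun U => U.1.card = t) = ∅ := by
      rw [← subset_empty, ← hempty]
      intro U hU
      simp only [mem_filter, mem_univ, true_and] at hU ⊢
      exact hU.2
    rw [hE, sum_empty, zero_div, mul_zero] at hrow
    have := abs_nonpos_iff.1 hrow
    rw [this]
    exact mul_nonneg (mul_nonneg hBv0 hε) (pow_nonneg hr'.le 2)
  · have h1 : (∑ U ∈ (A.filter fun U => U ∉ F').filter (fun U => U.1.card = t), (X U).trace) / N ≤ ε * r * r := by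
      rw [div_le_iff₀ hNpos]
      calc ∑ U ∈ (A.filter fun U => U ∉ F').filter (fun U => U.1.card = t), (X U).trace ≤ ∑ U ∈ F \ F', (X U).trace := hsub
        _ ≤ r * (ε * r * N) := hjunk
        _ = ε * r * r * N := by ring
    calc ∑ U ∈ A.filter (fun U => U ∉ F'), ∑ M, levelWeight n t C w U M * (X U * Y M).trace
        ≤ |∑ U ∈ A.filter (fun U => U ∉ F'), ∑ M, levelWeight n t C w U M * (X U * Y M).trace| := le_abs_self _
      _ ≤ (∑ c ∈ C, |w c|) * ((∑ U ∈ (A.filter fun U => U ∉ F').filter (fun U => U.1.card = t), (X U).trace) / N) := hrow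
      _ ≤ Bv * (ε * r * r) := mul_le_mul hBv h1 (div_nonneg (sum_nonneg fun U _ => (hXY.1 U).1.trace_nonneg) hNpos.le) hBv0
      _ = Bv * ε * r ^ 2 := by ring

end Summit.PneNP.PneNP.Theorems.ChebyshevTracialDesignRobustSpan
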